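/-
Origin: expansion seat `planner-pub-hodgecm-mc-axioms-1-g14-0`, handover #W30 2026-08-20T15:53:55Z md5 01f5c40a2cb6 (PKG 66a6ddca8f7b → 01f5c40a2cb6; 94 l.; MECHANICAL (iib-R) rewrite v3.1 of the PKG file as it stands (33 token edits; rules R1x1+RX[h₂]x32)) (`HOME/mc/pub-hodgecm-mc-axioms-1-g14/revendor/kit-r55/stage55/HodgeCM/Model/HLiuOfNorm.lean`, md5 01f5c40a2cb6, 94 lines);
landed by the gen-22 packager (p-g22) in gate run 55 REPLACES the earlier landed copy of `HodgeCM/Model/HLiuOfNorm.lean` (seat copy carried the packager Origin header of an earlier run (stripped)).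
-/
/-
RUN-37 `K`-ORDER TWIN by CONSTRUCTION seat `planner-pub-hodgecm-mc-axioms-1-g10-0` (unit pub-hodgecm-mc-axioms-1-g10, gen 10 of
mc-axioms-1, MODEL-DAG node N-i1 (L-lvl)), 2026-08-19, of the installed RUN-35 ″ row `HodgeCM/Model/HLiuOfNorm.lean` (kit t36 #12 555f8312671d,
installed ca8b84a22030) — WHOLE-FILE REPLACEMENT.
RE-TYPING OF RECORD (BINDER-TRIAGE §57/§58/§60; ±0 binders, no statement strengthened): the `hsmall` binder in the (W1)
`K`-order `∃ Γ₀, ∀ Γ ≤ Γ₀, …` (was `∀ Γ, Γ.Γ ≤ Γ₀.Γ → …`; [Liu21] «K sufficiently small»); the `norm`/`hnorm` data and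
`coverOf`/`pushOf` KEEP the `.Γ`-order (geometry).  ONE statement line changed vs the installed bytes; proof unchanged.
CONCLUSION = E's binder `hLiu` — `Model/E2InstanceR15A.lean` ″ 25ae7f12b9dc :86–:90 (= R10″ … R17A″) — BYTE-FOR-BYTE
(glue-1-g6 2026-08-19T15:58:17Z: the row-9 bytes for RUN 37 ARE today's; its RUN-37 corollary leaf `Model/E2InstanceR18[A]`
takes this file's `hsmall` text verbatim and applies the wrapper inside its body — nothing of this lineage enters the parent
E term).  (W1) WORLD member: INSTALL in the SAME run as the (W1) root `CM/Basic.lean` #342 66bed69a8c74 (kit t37-mcglue1g6.txt)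
and as this lineage's RUN-37 `LevelDescent` twin, after both; the four axioms-1 RUN-37 rows replace their installed twins
TOGETHER (none elaborates in a mixed world).
-/
/-
Origin: CONSTRUCTION seat `planner-pub-hodgecm-mc-axioms-1-g7-0` (unit pub-hodgecm-mc-axioms-1-g7, gen 7 of mc-axioms-1,
MODEL-DAG node N-i1 (L-lvl)), 2026-08-19.  NEW additive leaf `HodgeCM/Model/HLiuOfNorm.lean`.  ″ (JOINT-CUT) WORLD member: imports the ″ row `HLiuOfSmall` ef17b52e875f (no `hι` binder); its v1 twin is `pkg/HodgeCM/Model/HLiuOfNorm.lean` — install XOR.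
Imports: `E2InstanceR10` (names of the E term only), `Model/HLiuOfSmall` (gen 6/7 of this lineage) and `Model/LevelTransferOf`
(gen 7: the level-transfer datum with its PUSH HALF constructed).  Nothing imports this file (bounce-isolated).  No proof holes,
no records, nothing cited.  Expected `#print axioms`: {propext, Classical.choice, Quot.sound}.
CONTENT: ONE theorem `HodgeCM.Model.hLiu_of_norm` = the trade `hLiu ↦ (norm, hnorm, hsmall)` for E's R18: the binder `hLiu`
of `Model.perL_picardCM_rNcore` follows from the norm half of the transfer (two Prop/data binders over the KERNEL push
`Model.pushOf`) and the level-smallness hypothesis, by `hLiu_of_small` at `D := levelTransferFamilyOf … norm hnorm`.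
-/
import Summits.HodgeConjecture.HodgeCM.Model.E2InstanceR10
import Summits.HodgeConjecture.HodgeCM.Model.HLiuOfSmall
import Summits.HodgeConjecture.HodgeCM.Model.LevelTransferOf

/-! PORT of `HodgeCM/Model/HLiuOfNorm.lean` (HodgeCMPerL run 82) — verbatim mechanical port; provenance in the PORT header line. -/

noncomputable section

open scoped TensorProduct InnerProductSpace Matrix

namespace HodgeCM

namespace Model

open HodgeCM.Universe (AdelicThetaCore AdelicThetaCore₀ SideData ThetaModel ModelAxiomsPerL LevelTransfer)
open Literature.AlgebraicGeometry.Motives (CMType)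
open Literature.AlgebraicGeometry.HodgeTheory
open Literature.AlgebraicGeometry.ComplexMultiplication (Shimura1998_Thm3_isogenousPower Shimura1998_Thm2_Cor)
open Literature.NumberTheory.Automorphic.PicardCM
open Literature.NumberTheory.Transcendental (Arapura2012_Cor_15_4_6)
open HodgeCM.CMTypeOps (inflate)
open HodgeCM.Model.SupplyResidual (ClassSupplyPackN)
open HodgeCM.Model.ThetaSpace

variable (hHD : exists_isReal_hodgeModel) (hI : hodgePQ_independent_of_hodgeModel)
  (h₁ : BallQuotientUniformised)  (h₃ : CMAbelianVarietyRealised)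

/-- `hLiu_of_norm` — the R18-facing form of `hLiu_of_small`: E's binder `hLiu` (conclusion; text VERBATIM from
`E2InstanceR10.lean`, byte-identical in R10–R17, v1 = ″) from (i) the NORM HALF of the level-transfer datum as two explicit
binders `norm` / `hnorm` (for each morphism `F : X_{Γ₁} → A_{(K,Ψ)}` to a CM abelian variety of the universe a morphism
`N_F : X_Γ → A_{(K,Ψ)}` with `push ∘ₗ F^* = N_F^*` on `H¹`, where `push = pushOf …` is the KERNEL-CONSTRUCTED push of
`LevelTransferPush.lean` — `deg •` the transfer of the finite covering `coverOf … (ℂ)`), and (ii) `hsmall`, the level-smallness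
hypothesis in the (L-lvl) shape `∃ Γ₀ ∀ Γ ≤ Γ₀` (no neatness field).  Proof: `hLiu_of_small` at
`D := levelTransferFamilyOf … norm hnorm`.  So the trade `hLiu ↦ (norm, hnorm, hsmall)` is this one declaration. -/
theorem hLiu_of_norm (h : Bool) (hA : Arapura2012_Cor_15_4_6)
    (W : ∀ {L : CMField} {ι₁ : L →+* ℂ} (V : HermSpace3 L ι₁) (c : SeesawCtx L), WmInput V c.D)
    (S : ∀ {L : CMField} {ι₁ : L →+* ℂ} (V : HermSpace3 L ι₁) (c : SeesawCtx L), ThetaAdelicSide V c)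
    (μ : ∀ {L : CMField}, SeesawCtx L → Fin 4 → NumberField.InfinitePlace L → ℤ)
    (norm : ∀ {L : CMField} {ι₁ : L →+* ℂ} {V : HermSpace3 L ι₁} (Γ Γ₁ : Level V) (_hle : Γ₁.Γ ≤ Γ.Γ)
      (K : CMField) (Ψ : CMType K),
      (picardCMUniverse hHD hI h₁ h₃).Mor ((picardCMUniverse hHD hI h₁ h₃).pms L ι₁ V Γ₁)
          ((picardCMUniverse hHD hI h₁ h₃).cmAV K Ψ) →
        (picardCMUniverse hHD hI h₁ h₃).Mor ((picardCMUniverse hHD hI h₁ h₃).pms L ι₁ V Γ)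
          ((picardCMUniverse hHD hI h₁ h₃).cmAV K Ψ))
    (hnorm : ∀ {L : CMField} {ι₁ : L →+* ℂ} {V : HermSpace3 L ι₁} (Γ Γ₁ : Level V) (hle : Γ₁.Γ ≤ Γ.Γ)
      (K : CMField) (Ψ : CMType K)
      (F : (picardCMUniverse hHD hI h₁ h₃).Mor ((picardCMUniverse hHD hI h₁ h₃).pms L ι₁ V Γ₁)
        ((picardCMUniverse hHD hI h₁ h₃).cmAV K Ψ)),
      pushOf hHD hI h₁ h₃ hA Γ Γ₁ hle ∘ₗ (picardCMUniverse hHD hI h₁ h₃).pull F 1 =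
        (picardCMUniverse hHD hI h₁ h₃).pull (norm Γ Γ₁ hle K Ψ F) 1)
    (hsmall : ∀ {L : CMField} {ι₁ : L →+* ℂ} (V : HermSpace3 L ι₁) (c : SeesawCtx L),
      (thetaModelOf hHD hI h₁ h₃ h (embOf hHD hI h₁ h₃) (coverOf hHD hI h₁ h₃ hA) (wmOfInput W) (thetaOf _ (thetaClassInputOf _ (fun V c => thetaSpaceInputOf hHD hI h₁ h₃ S V c))) (d12Of μ) (d34Of μ)).GoodCtx ι₁ c → Module.finrank ℚ c.K = 6 →
      ∀ i : Fin 4, ∃ Γ₀ : Level V, ∀ Γ ≤ Γ₀,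
        ∃ (M : CMField) (k : c.K →+* M) (σ' : M →+* ℂ), σ'.comp k = c.σ ∧
        (thetaModelOf hHD hI h₁ h₃ h (embOf hHD hI h₁ h₃) (coverOf hHD hI h₁ h₃ hA) (wmOfInput W) (thetaOf _ (thetaClassInputOf _ (fun V c => thetaSpaceInputOf hHD hI h₁ h₃ S V c))) (d12Of μ) (d34Of μ)).Theta V c i Γ ⊆
          (picardCMUniverse hHD hI h₁ h₃).Uiso Γ M (inflate k (c.Ψ i)) σ') :
    ∀ {L : CMField} {ι₁ : L →+* ℂ} (V : HermSpace3 L ι₁) (c : SeesawCtx L),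
      (thetaModelOf hHD hI h₁ h₃ h (embOf hHD hI h₁ h₃) (coverOf hHD hI h₁ h₃ hA) (wmOfInput W) (thetaOf _ (thetaClassInputOf _ (fun V c => thetaSpaceInputOf hHD hI h₁ h₃ S V c))) (d12Of μ) (d34Of μ)).GoodCtx ι₁ c → Module.finrank ℚ c.K = 6 →
      ∀ (i : Fin 4) (Γ : Level V), ∃ (M : CMField) (k : c.K →+* M) (σ' : M →+* ℂ), σ'.comp k = c.σ ∧
        (thetaModelOf hHD hI h₁ h₃ h (embOf hHD hI h₁ h₃) (coverOf hHD hI h₁ h₃ hA) (wmOfInput W) (thetaOf _ (thetaClassInputOf _ (fun V c => thetaSpaceInputOf hHD hI h₁ h₃ S V c))) (d12Of μ) (d34Of μ)).Theta V c i Γ ⊆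
          (picardCMUniverse hHD hI h₁ h₃).Uiso Γ M (inflate k (c.Ψ i)) σ' :=
  hLiu_of_small hHD hI h₁ h₃ h hA W S μ (levelTransferFamilyOf hHD hI h₁ h₃ hA norm hnorm) hsmall

end Model

end HodgeCM

end
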